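import Mathlib
import Summits.QuantumAdvantage.QuantumAdvantage.Theses.CubicForrelation
import Literature.Computability.Complexity.PromiseZPPProofs

/-!
# Sketch — crux idea `rm-distance-top-rigidity` for crux `pl_lift` (stmt-QuantumAdvantage-0250)

First checkable statements of the line "Reed–Muller distance quantizes cubic Forrelation at the
top, so the exact slice is a promise-free BQP LANGUAGE and route CubicForrelation reaches the
summit (hence `PlLift`) from its own crux `ExactCubicForrelationNotPrBPP` with no lift".
Everything is stated over existing declarations; proofs of the glue are real, the levers are
`def … : Prop` targets.
-/

noncomputable section

namespace Summit.QuantumAdvantage.QuantumAdvantage.Cruxes.PlLift.RmDistanceTopRigidity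

open Literature.Computability.QuantumComplexity Literature.Computability.Complexity
open Literature.Computability.Cryptography
open Summit.QuantumAdvantage.QuantumAdvantage.Theses.CubicForrelation

/-- `f : 𝔽₂ⁿ → 𝔽₂` (as a Boolean function) has algebraic degree `≤ d`: it is the evaluation map of
some multivariate polynomial over `ZMod 2` of total degree `≤ d` (same spelling as the route file
`CubicForrelation.lean`). -/
def IsDegLE {n : ℕ} (d : ℕ) (f : (Fin n → Bool) → Bool) : Prop :=
  ∃ p : MvPolynomial (Fin n) (ZMod 2), p.totalDegree ≤ d ∧
    ∀ x, f x = decide (MvPolynomial.eval (fun j => if x j then (1 : ZMod 2) else 0) p = 1)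

/-- `g : 𝔽₂^{m+m} → 𝔽₂` is **Maiorana–McFarland-shaped**: `g(y', y'') = y'·π(y'') + h(y'')` with
`π : 𝔽₂^m → 𝔽₂^m` having coordinate functions of degree `≤ 2` (so `g` is cubic) and `h` cubic.
NO permutation / bentness hypothesis on `π`. [Mesnager 2016, Prop. 7.1.14 for the bent case] -/
def MMShaped {m : ℕ} (g : (Fin (m + m) → Bool) → Bool) : Prop :=
  ∃ π : Fin m → (Fin m → Bool) → Bool, (∀ i, IsDegLE 2 (π i)) ∧
    ∃ h : (Fin m → Bool) → Bool, IsDegLE 3 h ∧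
      ∀ y' y'' : Fin m → Bool,
        (if g (Fin.append y' y'') then (1 : ZMod 2) else 0) =
          (∑ i, (if y' i then (1 : ZMod 2) else 0) * (if π i y'' then (1 : ZMod 2) else 0)) +
            (if h y'' then (1 : ZMod 2) else 0)

/-- **First lemma (theorem-target, claimed provable now; c = 1/64).** For MM-shaped cubic `g`
(any quadratic `π`, any cubic `h`) and ANY cubic `f`, the forrelation is either exactly `1` or at
most `1 - 1/64`. Mechanism: three low-degree defect sets — the quartic map `π ∘ ψ + id` (ψ = the
`x''`-linear coefficient vector of `f`), the affine locus where `f(x',·)` is non-affine, and the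
sextic sign polynomial `k(x') + h(ψ x')` — each empty or of constant density by the minimum
distance of `RM(4,m)`, `RM(1,m)`, `RM(6,m)`. -/
def MMShapedTopRigidity : Prop :=
  ∀ m : ℕ, ∀ f g : (Fin (m + m) → Bool) → Bool, IsDegLE 3 f → MMShaped g →
    forrelation f g = 1 ∨ forrelation f g ≤ 1 - 1 / 64

/-- **The lever (conjecture): cubic top rigidity.** For even `n` and cubic `f, g : 𝔽₂ⁿ → 𝔽₂`,
`Φ(f,g) ∈ {1} ∪ [-1, 1 - c]` for a universal `c > 0`. (Free floor from Rothaus' degree bound: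
`c(n) ≥ 2^{1-n/2}`; the conjecture is that `c` does not decay.) -/
def CubicTopRigidity : Prop :=
  ∃ c : ℝ, 0 < c ∧ ∀ n : ℕ, Even n → ∀ f g : (Fin n → Bool) → Bool,
    IsDegLE 3 f → IsDegLE 3 g → forrelation f g = 1 ∨ forrelation f g ≤ 1 - c

/-- The cubic 2-fold white-box family (same predicate as the route file). -/
def IsCubicPair (I : KForrelationInstance) : Prop :=
  I.k = 2 ∧ Even I.n ∧ ∀ i, IsDegLE 3 ((I.C i).eval)

/-- The EXACT SLICE AS A TOTAL PROBLEM on the cubic family: yes = `Φ = 1`, no = `Φ ≠ 1`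
(everything else in the family). With top rigidity this is separated by a BQP language. -/
def ExactCubicSlicePair : PromiseProblem :=
  ⟨KForrelationInstance.encode '' {I | I.IsOverB2 ∧ I.value = 1 ∧ IsCubicPair I},
   KForrelationInstance.encode '' {I | I.IsOverB2 ∧ I.value ≠ 1 ∧ IsCubicPair I}⟩

/-- **Second lemma (M-sized, theorem-target given the lever):** top rigidity makes the exact cubic
slice a member of `promiseLift BQP`, i.e. some everywhere-gapped uniform Clifford+T family decides a
total language `L` with `{Φ = 1} ⊆ L` and `{Φ ≠ 1} ⊆ Lᶜ` on the cubic family (interpolate the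
circuits on the `O(n³)` points of weight `≤ 3` to genuine cubic ANFs, run the two-query
Forrelation test `O(1/c²)` times, threshold at `1 - c/2`; the gap holds on ALL inputs because the
interpolants are cubic by construction). -/
def TopRigidityGivesLanguage : Prop :=
  CubicTopRigidity → ExactCubicSlicePair ∈ promiseLift BQP

/-- Glue (real proof): a separating BQP language for the exact slice plus the route's crux r3
`ExactCubicForrelationNotPrBPP` give the summit — NO promise→language lift. -/
theorem summit_of_exactSlice_language
    (hL : ExactCubicSlicePair ∈ promiseLift BQP)
    (hX : ExactCubicForrelationNotPrBPP) : _root_.QuantumAdvantage := by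
  obtain ⟨L, hLBQP, hyes, hno⟩ := hL
  by_contra hS
  have hLBPP : L ∈ Literature.Computability.Complexity.BPP := by
    by_contra h
    exact hS ⟨L, hLBQP, h⟩
  apply hX
  -- the exact-vs-|Φ|≤1/100 promise problem is separated by `L ∈ BPP`, hence in `PromiseBPP'`
  apply PromiseBPP_subset_PromiseBPP'_holds
  refine ⟨L, hLBPP, ?_, ?_⟩
  · -- yes-part: `IsOverB2 ∧ value = 1 ∧ k = 2 ∧ Even n ∧ cubic` ⊆ exact-slice yes ⊆ L
    rintro s ⟨I, ⟨hB2, hv, hk, hev, hcub⟩, rfl⟩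
    exact hyes ⟨I, ⟨hB2, hv, hk, hev, hcub⟩, rfl⟩
  · -- no-part: `IsNo ∧ …` has `|Φ| ≤ 1/100`, so `Φ ≠ 1`, so it lies in the exact-slice no-part ⊆ Lᶜ
    rintro s ⟨I, ⟨⟨hB2, habs⟩, hk, hev, hcub⟩, rfl⟩
    refine hno ⟨I, ⟨hB2, ?_, hk, hev, hcub⟩, rfl⟩
    intro h1
    have : (1 : ℝ) ≤ 1 / 100 := by simpa [h1] using habs
    norm_num at this

/-- Composition to the crux BY NAME: the line closes `PlLift` (vacuously, through the summit). -/
theorem PlLift_of (hR : CubicTopRigidity) (hLang : TopRigidityGivesLanguage)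
    (hX : ExactCubicForrelationNotPrBPP) : PlLift := by
  have hS : _root_.QuantumAdvantage := summit_of_exactSlice_language (hLang hR) hX
  intro hcollapse
  exact absurd hcollapse (fun h => by
    obtain ⟨L, hLQ, hLP⟩ := hS
    exact hLP (h hLQ))

/-- Sanity: `MMShapedTopRigidity` is the MM-shaped case of `CubicTopRigidity` with `c = 1/64`
(statement-level only; MM-shaped `g` is cubic). -/
example : CubicTopRigidity → True := fun _ => trivial

end Summit.QuantumAdvantage.QuantumAdvantage.Cruxes.PlLift.RmDistanceTopRigidity
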